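import Summits.PneNP.PneNP.Theorems.PhaseTwinsPolyDepthTwinsAboveConnectorFibres

/-!
# Route PhaseTwins, crux `PolyDepthTwinsAbove` (stmt-PneNP-2719), line `parity-wired-ports`:
# `stub_connector`, part 1 — configurations of the parity-wired graph

Sly's Lemma 2.2 for the parity wiring, combinatorial half. A configuration of `pwGraph R W c` splits into
its COPY part (a configuration of the `6M` gadget copies, i.e. a family of configurations of the gadget
`W.G`) and its COMPLEX part (ends and inner vertices of the `M κ₂` CFI complexes):

* `isIndepSet_cxGraph_iff`, `isIndepSet_pwBase_iff`, `isIndepSet_pwGraph_iff` — independence in the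
  complex, in the disjoint union of the copies, and in the parity-wired graph (fibres independent in `G`,
  no pair edge doubly occupied, occupied ends plug into vacant ports, CFI adjacency inside each complex);
* `sum_cxPart_eq_prod` — given which ports are occupied, the total weight of the complex parts is the
  product over the complexes of the local factors `cxWeight (c w) λ x`, `x ∈ {0,1}` the vacancy indicators;
* the pattern-level objects `endPort`, `pwPatFactor` used by parts 2–4.
(Part 2, `…ConnectorDecomp`: the split into copy/complex parts, `Z_{base}(Y)` and the grouping of
`Z_{pwGraph c}(Y)` by port configurations.) [cite: Sly2010, Lemma 2.2 (proof); folklore bookkeeping]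
-/

noncomputable section

open scoped Classical BigOperators

namespace Summit.PneNP.PneNP.Cruxes.PolyDepthTwinsAbove.ParityWiredPorts

open Finset
open Literature.Computability.Complexity (hardcoreZOn hardcoreZOn_def slyPhase portPattern
  mem_portPattern_fst mem_portPattern_snd SlyReduction.isIndepSet_coe_finset_iff)
open Literature.Computability.Complexity.Expander (RotGraph)
open Literature.ModelTheory.FiniteModelTheory.TseitinColouring (Dart)
open Literature.ModelTheory.FiniteModelTheory.CFIMatching (bit Canon zmod2_eq_zero_or_one)
open Literature.Probability.LatticeModels (independencePolynomial)

set_option linter.dupNamespace false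

variable {M v m κ₁ κ₂ : ℕ}

/-! ## Sly's Lemma 2.2 for the parity wiring: pattern-level objects (`stub_connector`) -/

/-- The COPY VERTEX an end vertex plugs into: end `(w, i, a, j)` is adjacent exactly to the `V⁺` port in
end slot `(side, j)` of the copy `g_{canon(w,i), a}` (`pwRel`, end–copy clause). -/
def endPort (R : RotGraph M 3) (W : Wiring v m κ₁ κ₂) (e : Fin M × Fin 3 × ZMod 2 × Fin κ₂) :
    Dart M 3 × ZMod 2 × Fin v :=
  ((canonEnd R (e.1, e.2.1)).1, e.2.2.1, W.Vp (W.slot (Sum.inr ((canonEnd R (e.1, e.2.1)).2, e.2.2.2))))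

/-- **The pattern factor** of a family `P` of port configurations (`P g = (S⁺, S⁻)`, the occupied `V⁺`/`V⁻`
port indices of copy `g`): the indicator that no PAIR edge of `pwGraph` is doubly occupied (pair slot
`inl j` occupied in both `g_{δ,0}` and `g_{δ,1}`, `δ` canonical, on the `V⁺` or on the `V⁻` side), times the
total weight of the END/INNER vertices given the ports — the product over the complexes `(w, j)` of the
local factor `cxWeight (c w) λ x` at the vacancy indicators `x (i, a) ∈ {0, 1}` of the ports the six ends
plug into. Sly's Lemma 2.2 for this wiring reads: `Z_{pwGraph c}(λ; phases Y) = Σ_P pwPatFactor P ·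
Π_g Z_G(λ; Y_g, σ_V = P g)`, and under the product measures `Q^{Y_g}` the factor averages to
`pwW c Y · (1+λ)^{10 M κ₂}`. -/
def pwPatFactor (R : RotGraph M 3) (W : Wiring v m κ₁ κ₂) (lam : ℝ) (c : Fin M → ZMod 2)
    (P : Dart M 3 × ZMod 2 → Finset (Fin m) × Finset (Fin m)) : ℝ :=
  (if ∀ δ : Dart M 3, Canon R δ → ∀ j : Fin κ₁,
      ¬ (W.slot (Sum.inl j) ∈ (P (δ, 0)).1 ∧ W.slot (Sum.inl j) ∈ (P (δ, 1)).1) ∧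
        ¬ (W.slot (Sum.inl j) ∈ (P (δ, 0)).2 ∧ W.slot (Sum.inl j) ∈ (P (δ, 1)).2) then 1 else 0) *
    ∏ k : Fin M × Fin κ₂, cxWeight (c k.1) lam fun l =>
      if W.slot (Sum.inr ((canonEnd R (k.1, l.1)).2, k.2)) ∈ (P ((canonEnd R (k.1, l.1)).1, l.2)).1
      then 0 else 1


/-! ## Independence in the CFI complex -/

/-- **Independent sets of the complex**: a set of complex vertices is independent iff no occupied inner
vertex `S'` sees an occupied end `(i, bit e S' i)`. -/
theorem isIndepSet_cxGraph_iff (e : ZMod 2) (J : Finset CxVert) :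
    (cxGraph e).IsIndepSet (↑J : Set CxVert) ↔
      ∀ S' : Fin 2 → ZMod 2, (Sum.inr S' : CxVert) ∈ J → ∀ i : Fin 3, (Sum.inl (i, bit e S' i) : CxVert) ∉ J := by
  rw [SlyReduction.isIndepSet_coe_finset_iff]
  constructor
  · intro h S' hS i hi
    refine h _ hS _ hi ?_
    rw [cxGraph_adj]
    exact ⟨by simp, Or.inl rfl⟩
  · rintro h x hx y hy hxy
    rw [cxGraph_adj] at hxy
    obtain ⟨-, hr | hr⟩ := hxy
    · rcases x with ⟨i, a⟩ | S' <;> rcases y with ⟨i', a'⟩ | S'' <;> simp only [cxRel] at hr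
      subst hr
      exact h S' hx i' hy
    · rcases x with ⟨i, a⟩ | S' <;> rcases y with ⟨i', a'⟩ | S'' <;> simp only [cxRel] at hr
      subst hr
      exact h S'' hy i hx

/-- With `{0,1}`-valued vacancies the end factor of `cxWeight` is an indicator. -/
theorem prod_ite_mem_eq_ite (J : Finset CxVert) (occ : Fin 3 × ZMod 2 → Prop) [DecidablePred occ] :
    (∏ p : Fin 3 × ZMod 2, (if (Sum.inl p : CxVert) ∈ J then (if occ p then (0 : ℝ) else 1) else 1)) =
      if ∀ p : Fin 3 × ZMod 2, (Sum.inl p : CxVert) ∈ J → ¬ occ p then 1 else 0 := by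
  rw [← Fintype.prod_boole]
  refine prod_congr rfl fun p _ => ?_
  by_cases h1 : (Sum.inl p : CxVert) ∈ J <;> by_cases h2 : occ p <;> simp [h1, h2]

/-- **The local factor at `{0,1}`-valued vacancies** is the weight of the admissible complex parts: those
whose occupied ends plug into vacant ports. -/
theorem cxWeight_indicator (e : ZMod 2) (lam : ℝ) (occ : Fin 3 × ZMod 2 → Prop) [DecidablePred occ] :
    cxWeight e lam (fun p => if occ p then 0 else 1) =
      ∑ J : Finset CxVert,
        if (∀ p : Fin 3 × ZMod 2, (Sum.inl p : CxVert) ∈ J → ¬ occ p) ∧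
            (∀ S' : Fin 2 → ZMod 2, (Sum.inr S' : CxVert) ∈ J → ∀ i : Fin 3,
              (Sum.inl (i, bit e S' i) : CxVert) ∉ J)
        then lam ^ J.card else 0 := by
  unfold cxWeight
  refine sum_congr rfl fun J _ => ?_
  by_cases hA : ∀ S' : Fin 2 → ZMod 2, (Sum.inr S' : CxVert) ∈ J → ∀ i : Fin 3,
      (Sum.inl (i, bit e S' i) : CxVert) ∉ J
  · have hind : (cxGraph e).IsIndepSet (↑J : Set CxVert) := (isIndepSet_cxGraph_iff e J).2 hA
    rw [if_pos hind, prod_ite_mem_eq_ite J occ]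
    by_cases hB : ∀ p : Fin 3 × ZMod 2, (Sum.inl p : CxVert) ∈ J → ¬ occ p
    · rw [if_pos hB, if_pos ⟨hB, hA⟩, mul_one]
    · rw [if_neg hB, if_neg (fun h => hB h.1), mul_zero]
  · have hind : ¬ (cxGraph e).IsIndepSet (↑J : Set CxVert) := fun h => hA ((isIndepSet_cxGraph_iff e J).1 h)
    rw [if_neg hind, if_neg (fun h => hA h.2)]

/-! ## The complex parts integrate to the product of the local factors -/

/-- **Total weight of the complex parts, given the occupied ports.** For a predicate `occ` on end vertices
(the port the end plugs into is occupied), the sum of `λ^{|I₂|}` over the sets `I₂` of ends/inner vertices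
that avoid occupied ports and respect the CFI adjacency inside each complex is the product over the
complexes `(w, j)` of `cxWeight (c w) λ (vacancy indicators)`. -/
theorem sum_cxPart_eq_prod (c : Fin M → ZMod 2) (lam : ℝ)
    (occ : Fin M × Fin 3 × ZMod 2 × Fin κ₂ → Prop) [DecidablePred occ] :
    ∑ I₂ : Finset ((Fin M × Fin 3 × ZMod 2 × Fin κ₂) ⊕ (Fin M × (Fin 2 → ZMod 2) × Fin κ₂)),
      (if (∀ e, Sum.inl e ∈ I₂ → ¬ occ e) ∧
          (∀ (w : Fin M) (S' : Fin 2 → ZMod 2) (j : Fin κ₂), Sum.inr (w, S', j) ∈ I₂ →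
            ∀ i : Fin 3, Sum.inl (w, i, bit (c w) S' i, j) ∉ I₂)
        then lam ^ I₂.card else 0) =
      ∏ k : Fin M × Fin κ₂, cxWeight (c k.1) lam fun l => if occ (k.1, l.1, l.2, k.2) then 0 else 1 := by
  -- reindex the complex part by (complex, complex vertex)
  let ψ : ((Fin M × Fin 3 × ZMod 2 × Fin κ₂) ⊕ (Fin M × (Fin 2 → ZMod 2) × Fin κ₂)) ≃
      (Fin M × Fin κ₂) × CxVert :=
    { toFun := fun x => match x with
        | Sum.inl (w, i, a, j) => ((w, j), Sum.inl (i, a))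
        | Sum.inr (w, S', j) => ((w, j), Sum.inr S')
      invFun := fun y => match y with
        | ((w, j), Sum.inl (i, a)) => Sum.inl (w, i, a, j)
        | ((w, j), Sum.inr S') => Sum.inr (w, S', j)
      left_inv := by rintro (⟨w, i, a, j⟩ | ⟨w, S', j⟩) <;> rfl
      right_inv := by rintro ⟨⟨w, j⟩, ⟨i, a⟩ | S'⟩ <;> rfl }
  have hψl : ∀ (w : Fin M) (i : Fin 3) (a : ZMod 2) (j : Fin κ₂),
      ψ (Sum.inl (w, i, a, j)) = ((w, j), Sum.inl (i, a)) := fun _ _ _ _ => rfl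
  have hψr : ∀ (w : Fin M) (S' : Fin 2 → ZMod 2) (j : Fin κ₂),
      ψ (Sum.inr (w, S', j)) = ((w, j), Sum.inr S') := fun _ _ _ => rfl
  -- the summand as a function of the reindexed configuration
  set F : Finset ((Fin M × Fin κ₂) × CxVert) → ℝ := fun T =>
    if ∀ k : Fin M × Fin κ₂,
        (∀ p : Fin 3 × ZMod 2, (Sum.inl p : CxVert) ∈ (univ.filter fun z => (k, z) ∈ T) →
            ¬ occ (k.1, p.1, p.2, k.2)) ∧
          (∀ S' : Fin 2 → ZMod 2, (Sum.inr S' : CxVert) ∈ (univ.filter fun z => (k, z) ∈ T) →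
            ∀ i : Fin 3, (Sum.inl (i, bit (c k.1) S' i) : CxVert) ∉ (univ.filter fun z => (k, z) ∈ T))
      then lam ^ T.card else 0 with hF
  have step1 : ∑ I₂ : Finset ((Fin M × Fin 3 × ZMod 2 × Fin κ₂) ⊕ (Fin M × (Fin 2 → ZMod 2) × Fin κ₂)),
      (if (∀ e, Sum.inl e ∈ I₂ → ¬ occ e) ∧
          (∀ (w : Fin M) (S' : Fin 2 → ZMod 2) (j : Fin κ₂), Sum.inr (w, S', j) ∈ I₂ →
            ∀ i : Fin 3, Sum.inl (w, i, bit (c w) S' i, j) ∉ I₂)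
        then lam ^ I₂.card else 0) = ∑ T : Finset ((Fin M × Fin κ₂) × CxVert), F T := by
    refine Fintype.sum_equiv (Equiv.finsetCongr ψ) _ _ fun I₂ => ?_
    rw [hF, Equiv.finsetCongr_apply]
    dsimp only
    rw [card_map]
    simp only [mem_filter, mem_univ, true_and, mem_map_equiv]
    have hmem : ∀ (k : Fin M × Fin κ₂) (z : CxVert), ψ.symm (k, z) ∈ I₂ ↔
        (match z with
          | Sum.inl p => Sum.inl (k.1, p.1, p.2, k.2)
          | Sum.inr S' => Sum.inr (k.1, S', k.2)) ∈ I₂ := by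
      rintro ⟨w, j⟩ (⟨i, a⟩ | S') <;> rfl
    simp only [hmem]
    congr 1
    refine propext ⟨fun ⟨h1, h2⟩ k => ⟨fun p hp => h1 _ hp, fun S' hS i hi => h2 k.1 S' k.2 hS i hi⟩,
      fun h => ⟨?_, ?_⟩⟩
    · rintro ⟨w, i, a, j⟩ he
      exact (h (w, j)).1 (i, a) he
    · intro w S' j hS i hi
      exact (h (w, j)).2 S' hS i hi
  rw [step1]
  -- the summand factorises over the complexes
  have step2 : ∀ T : Finset ((Fin M × Fin κ₂) × CxVert), F T =
      ∏ k : Fin M × Fin κ₂,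
        (if (∀ p : Fin 3 × ZMod 2, (Sum.inl p : CxVert) ∈ (univ.filter fun z => (k, z) ∈ T) →
              ¬ occ (k.1, p.1, p.2, k.2)) ∧
            (∀ S' : Fin 2 → ZMod 2, (Sum.inr S' : CxVert) ∈ (univ.filter fun z => (k, z) ∈ T) →
              ∀ i : Fin 3, (Sum.inl (i, bit (c k.1) S' i) : CxVert) ∉ (univ.filter fun z => (k, z) ∈ T))
        then lam ^ (univ.filter fun z => (k, z) ∈ T).card else 0) := by
    intro T
    rw [hF]
    dsimp only
    split_ifs with h
    · rw [card_eq_sum_card_fib T, ← prod_pow_eq_pow_sum]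
      refine prod_congr rfl fun k _ => ?_
      split_ifs with hk
      · rfl
      · exact absurd (h k) hk
    · obtain ⟨k, hk⟩ := not_forall.1 h
      symm
      refine prod_eq_zero (mem_univ k) ?_
      simp only [hk, if_false]
  simp_rw [step2]
  symm
  simp_rw [cxWeight_indicator]
  rw [Fintype.prod_sum, ← sum_eq_sum_fib (fun S : Fin M × Fin κ₂ → Finset CxVert => ∏ k : Fin M × Fin κ₂,
    (if (∀ p : Fin 3 × ZMod 2, (Sum.inl p : CxVert) ∈ S k → ¬ occ (k.1, p.1, p.2, k.2)) ∧
        (∀ S' : Fin 2 → ZMod 2, (Sum.inr S' : CxVert) ∈ S k → ∀ i : Fin 3,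
          (Sum.inl (i, bit (c k.1) S' i) : CxVert) ∉ S k)
      then lam ^ (S k).card else 0))]

/-! ## Independence in the disjoint union of the copies and in the parity-wired graph -/

/-- Membership in a copy fibre. -/
theorem mem_copyFib (I : Finset (PWVert M v κ₂)) (g : Dart M 3 × ZMod 2) (x : Fin v) :
    x ∈ copyFib I g ↔ (Sum.inl (g.1, g.2, x) : PWVert M v κ₂) ∈ I := by
  simp [copyFib]

/-- **Independent sets of `pwBase`** (disjoint copies, isolated complex vertices): a configuration is
independent iff every copy fibre is independent in the gadget. -/
theorem isIndepSet_pwBase_iff (W : Wiring v m κ₁ κ₂) (I : Finset (PWVert M v κ₂)) :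
    (pwBase M κ₂ W).IsIndepSet (↑I : Set (PWVert M v κ₂)) ↔
      ∀ g : Dart M 3 × ZMod 2, W.G.IsIndepSet (↑(copyFib I g) : Set (Fin v)) := by
  simp only [SlyReduction.isIndepSet_coe_finset_iff, mem_copyFib]
  constructor
  · intro h g x hx y hy hxy
    refine h _ hx _ hy ?_
    rw [pwBase_adj]
    refine ⟨fun heq => W.G.ne_of_adj hxy ?_, Or.inl ⟨rfl, rfl, hxy⟩⟩
    simpa using heq
  · rintro h a ha b hb hab
    rw [pwBase_adj] at hab
    obtain ⟨-, hr | hr⟩ := hab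
    · rcases a with ⟨δ, e, x⟩ | ⟨w, i, e, j⟩ | ⟨w, S', j⟩ <;>
        rcases b with ⟨δ', e', y⟩ | ⟨w', i', e', j'⟩ | ⟨w', S'', j'⟩ <;>
        simp only [pwBaseRel] at hr
      obtain ⟨h₁, h₂, hxy⟩ := hr
      rw [h₁, h₂] at hb
      exact h (δ, e) x ha y hb hxy
    · rcases a with ⟨δ, e, x⟩ | ⟨w, i, e, j⟩ | ⟨w, S', j⟩ <;>
        rcases b with ⟨δ', e', y⟩ | ⟨w', i', e', j'⟩ | ⟨w', S'', j'⟩ <;>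
        simp only [pwBaseRel] at hr
      obtain ⟨h₁, h₂, hxy⟩ := hr
      rw [h₁, h₂] at ha
      exact h (δ', e') y hb x ha hxy

/-- `1 + 1 = 0` in `ZMod 2`. -/
theorem zmod2_one_add_one : (1 : ZMod 2) + 1 = 0 := by decide

/-- The generating relation of `pwGraph` never holds inside an admissible configuration. -/
theorem not_pwRel_of_conditions (R : RotGraph M 3) (W : Wiring v m κ₁ κ₂) (c : Fin M → ZMod 2)
    (I : Finset (PWVert M v κ₂))
    (h1 : ∀ g : Dart M 3 × ZMod 2, W.G.IsIndepSet (↑(copyFib I g) : Set (Fin v)))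
    (h2 : ∀ δ : Dart M 3, Canon R δ → ∀ j : Fin κ₁,
      ¬ ((Sum.inl (δ, 0, W.Vp (W.slot (Sum.inl j))) : PWVert M v κ₂) ∈ I ∧
          (Sum.inl (δ, 1, W.Vp (W.slot (Sum.inl j))) : PWVert M v κ₂) ∈ I) ∧
        ¬ ((Sum.inl (δ, 0, W.Vm (W.slot (Sum.inl j))) : PWVert M v κ₂) ∈ I ∧
          (Sum.inl (δ, 1, W.Vm (W.slot (Sum.inl j))) : PWVert M v κ₂) ∈ I))
    (h3 : ∀ e : Fin M × Fin 3 × ZMod 2 × Fin κ₂, (Sum.inr (Sum.inl e) : PWVert M v κ₂) ∈ I →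
      (Sum.inl (endPort R W e) : PWVert M v κ₂) ∉ I)
    (h4 : ∀ (w : Fin M) (S' : Fin 2 → ZMod 2) (j : Fin κ₂),
      (Sum.inr (Sum.inr (w, S', j)) : PWVert M v κ₂) ∈ I →
        ∀ i : Fin 3, (Sum.inr (Sum.inl (w, i, bit (c w) S' i, j)) : PWVert M v κ₂) ∉ I)
    {a b : PWVert M v κ₂} (ha : a ∈ I) (hb : b ∈ I) (hr : pwRel R W c a b) : False := by
  rcases a with ⟨δ, e, x⟩ | ⟨w, i, e, j⟩ | ⟨w, S', j⟩ <;>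
    rcases b with ⟨δ', e', y⟩ | ⟨w', i', e', j'⟩ | ⟨w', S'', j'⟩ <;>
    simp only [pwRel] at hr
  · -- copy / copy
    rcases hr with ⟨h₁, h₂, hxy⟩ | ⟨hc, h₁, h₂, jj, hj⟩
    · rw [h₁, h₂] at hb
      exact (SlyReduction.isIndepSet_coe_finset_iff _ _).1 (h1 (δ, e)) x
        ((mem_copyFib I (δ, e) x).2 ha) y ((mem_copyFib I (δ, e) y).2 hb) hxy
    · rw [h₁, h₂] at hb
      rcases hj with ⟨rfl, rfl⟩ | ⟨rfl, rfl⟩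
      · rcases zmod2_eq_zero_or_one e with rfl | rfl
        · exact (h2 δ hc jj).1 ⟨ha, by simpa using hb⟩
        · exact (h2 δ hc jj).1 ⟨by simpa [zmod2_one_add_one] using hb, ha⟩
      · rcases zmod2_eq_zero_or_one e with rfl | rfl
        · exact (h2 δ hc jj).2 ⟨ha, by simpa using hb⟩
        · exact (h2 δ hc jj).2 ⟨by simpa [zmod2_one_add_one] using hb, ha⟩
  · -- end / copy
    obtain ⟨h₁, h₂, h₃⟩ := hr
    rw [h₁, h₂, h₃] at hb
    exact h3 (w, i, e, j) ha (by simpa [endPort] using hb)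
  · -- inner / end
    obtain ⟨h₁, h₂, h₃⟩ := hr
    rw [h₁, h₂, ← h₃] at hb
    exact h4 w S' j ha i' hb

/-- **Independent sets of the parity-wired graph**: every copy fibre independent in the gadget, no PAIR
edge doubly occupied, every occupied END plugged into a vacant port, and the CFI adjacency respected
inside every complex. -/
theorem isIndepSet_pwGraph_iff (R : RotGraph M 3) (W : Wiring v m κ₁ κ₂) (c : Fin M → ZMod 2)
    (I : Finset (PWVert M v κ₂)) :
    (pwGraph R W c).IsIndepSet (↑I : Set (PWVert M v κ₂)) ↔
      (∀ g : Dart M 3 × ZMod 2, W.G.IsIndepSet (↑(copyFib I g) : Set (Fin v))) ∧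
      (∀ δ : Dart M 3, Canon R δ → ∀ j : Fin κ₁,
        ¬ ((Sum.inl (δ, 0, W.Vp (W.slot (Sum.inl j))) : PWVert M v κ₂) ∈ I ∧
            (Sum.inl (δ, 1, W.Vp (W.slot (Sum.inl j))) : PWVert M v κ₂) ∈ I) ∧
          ¬ ((Sum.inl (δ, 0, W.Vm (W.slot (Sum.inl j))) : PWVert M v κ₂) ∈ I ∧
            (Sum.inl (δ, 1, W.Vm (W.slot (Sum.inl j))) : PWVert M v κ₂) ∈ I)) ∧
      (∀ e : Fin M × Fin 3 × ZMod 2 × Fin κ₂, (Sum.inr (Sum.inl e) : PWVert M v κ₂) ∈ I →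
        (Sum.inl (endPort R W e) : PWVert M v κ₂) ∉ I) ∧
      (∀ (w : Fin M) (S' : Fin 2 → ZMod 2) (j : Fin κ₂),
        (Sum.inr (Sum.inr (w, S', j)) : PWVert M v κ₂) ∈ I →
          ∀ i : Fin 3, (Sum.inr (Sum.inl (w, i, bit (c w) S' i, j)) : PWVert M v κ₂) ∉ I) := by
  rw [SlyReduction.isIndepSet_coe_finset_iff]
  constructor
  · intro h
    refine ⟨fun g => ?_, fun δ hδ j => ⟨?_, ?_⟩, fun e he hp => ?_, fun w S' j hS i hi => ?_⟩
    · rw [SlyReduction.isIndepSet_coe_finset_iff]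
      intro x hx y hy hxy
      rw [mem_copyFib] at hx hy
      refine h _ hx _ hy ?_
      rw [pwGraph_adj]
      refine ⟨fun heq => W.G.ne_of_adj hxy ?_, Or.inl (Or.inl ⟨rfl, rfl, hxy⟩)⟩
      simpa using heq
    · rintro ⟨h0, h1⟩
      refine h _ h0 _ h1 ?_
      rw [pwGraph_adj]
      refine ⟨by simp, Or.inl (Or.inr ⟨hδ, rfl, by simp, j, Or.inl ⟨rfl, rfl⟩⟩)⟩
    · rintro ⟨h0, h1⟩
      refine h _ h0 _ h1 ?_
      rw [pwGraph_adj]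
      refine ⟨by simp, Or.inl (Or.inr ⟨hδ, rfl, by simp, j, Or.inr ⟨rfl, rfl⟩⟩)⟩
    · obtain ⟨w, i, a, j⟩ := e
      refine h _ he _ hp ?_
      rw [pwGraph_adj]
      exact ⟨by simp, Or.inl ⟨rfl, rfl, rfl⟩⟩
    · refine h _ hS _ hi ?_
      rw [pwGraph_adj]
      exact ⟨by simp, Or.inl ⟨rfl, rfl, rfl⟩⟩
  · rintro ⟨h1, h2, h3, h4⟩ a ha b hb hab
    rw [pwGraph_adj] at hab
    obtain ⟨-, hr | hr⟩ := hab
    · exact not_pwRel_of_conditions R W c I h1 h2 h3 h4 ha hb hr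
    · exact not_pwRel_of_conditions R W c I h1 h2 h3 h4 hb ha hr

end Summit.PneNP.PneNP.Cruxes.PolyDepthTwinsAbove.ParityWiredPorts
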